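import Literature.NumberTheory.Automorphic.BookerKrishnamurthyConverse
import Literature.NumberTheory.Automorphic.GLOneOfHeckeCharacterBJ
import Literature.NumberTheory.GaloisRepresentations.ArtinEulerProductProofs
import Mathlib.NumberTheory.Real.Irrational
import HarnessLib

/-!
# Booker–Krishnamurthy converse theorem: proved lemmas on the archimedean parameters

Companion of `Automorphic/BookerKrishnamurthyConverse`, which vendors Booker–Krishnamurthy,
*A strengthening of the GL(2) converse theorem*, Compositio Math. 147 (2011), Cor. 1.2 (p. 670)
as the named fact `bookerKrishnamurthy_isPiOfArtinRep_of_entire_twists`. The hypothesis of that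
fact reads the complete twisted `L`-function `artinTwistCompletedL σ P ω = Λ(s, σ ⊗ ω)` through a
family `P` of archimedean parameters of `ω` (`ω.HasArchParams P`), quantified as
`∀ P, ω.HasArchParams P → …`. Op. cit. §1.1 (p. 672): "for `v ∈ S_ℝ`, `χ_v` may be written
**uniquely** in the form `χ_v(y) = ‖y‖_v^{ν(χ_v)} sgn_v(y)^{ε(χ_v)}` … similarly, for `v ∈ S_ℂ`,
we have `χ_v(y) = ‖y‖_v^{ν(χ_v)} θ_v(y)^{k(χ_v)}`". This file PROVES that existence and
uniqueness over the tree's carriers (for every CONTINUOUS quasi-character of `F_wˣ`, in particular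
for the components `ω_w` of an idèle class character, which are continuous) and draws the
consequences for the hypothesis of the named fact:

* `HasRealParam.unique`, `HasComplexParam.unique` — `(ν, ε)` at a real place, `(ν, k)` at a
  complex place, are determined by the character;
* `artinTwistGammaFactor_congr`, `artinTwistCompletedL_congr` — two parameter families of the
  same idèle class character give the same archimedean factor and the same `Λ(s, σ ⊗ ω)`;
* `HeckeCharacter.continuous_archComponent`, `exists_hasRealParam_of_continuous`,
  `exists_hasComplexParam_of_continuous`, `HeckeCharacter.exists_hasArchParams` — every idèle
  class character `ω` HAS a parameter family `P` (`ω.HasArchParams P`);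
* `multipliable_artinTwistLFunction`, `hasProd_artinTwistLFunction` — for unitary `ω` and
  `re s > 1` the twisted Euler product `∏_v det(1 - ω_v(ϖ_v) q_v^{-s} Frob_v | V^{I_v})⁻¹`
  converges (unconditionally) to `artinTwistLFunction σ ω s`, so on the half-plane read by
  `LFunction.HasEntireContinuation` the `tprod` is the genuine value (hypothesis (i) of op. cit.
  Thm. 1.1 for `Λ(s, σ ⊗ ω)`, with `σ = 1`);
* `forall_hasArchParams_hasEntireContinuation_iff` — consequently the clause
  `∀ P, ω.HasArchParams P → HasEntireContinuation (Λ P)` of the named fact is equivalent to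
  `∃ P, ω.HasArchParams P ∧ HasEntireContinuation (Λ P)`: the universal quantifier over `P`
  neither over-constrains (uniqueness) nor empties (existence) the printed hypothesis
  "`Λ(s, ρ ⊗ ω)` is entire".

The elementary inputs are `w.Completion ≃ ℝ` (resp. `≃ ℂ`) isometrically (Mathlib
`extensionEmbeddingOfIsReal`, `extensionEmbedding`, their isometry and surjectivity), the
periodicity of `Complex.exp` (`Complex.exp_eq_exp_iff_exists_int`), the irrationality of `√2`
(to separate `t ↦ t^ν` from `t ↦ t^{ν'}` on `ℝ_{>0}`), and the tree's classification of continuous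
one-parameter groups `ℝ → ℂˣ` (`exists_eq_exp_mul_of_continuous_hom`,
`Automorphic/GLOneOfHeckeCharacterBJ`; Hewitt–Ross (23.27)) applied to the radial and angular
one-parameter subgroups of `F_wˣ`.

The named fact itself (the `GL(2)` converse theorem with unramified twists) is NOT proved here:
its printed proof (op. cit. §§3–5, pp. 676–710, on top of Jacquet–Langlands' theory, the local
Langlands correspondence for `GL(2)` and the analytic theory of Weil-group `L`-functions) has no
counterpart in the tree.

## References

* A. R. Booker, M. Krishnamurthy, Compositio Math. 147 (2011), §1.1 (p. 672), Cor. 1.2 (p. 670).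
  [BookerKrishnamurthy2011]
* J. Tate, *Number theoretic background*, Corvallis 1979, §3 (quasi-characters of `ℝˣ`, `ℂˣ`).
  [TateCorvallis1979]
-/

noncomputable section

open scoped NumberField
open NumberField NumberField.InfinitePlace IsDedekindDomain Complex
open Literature.NumberTheory.GaloisRepresentations

namespace Literature.NumberTheory.Automorphic

universe u

/-! ### Exponents of characters of `ℝ_{>0}` and of the circle -/

/-- If `t ^ ν = t ^ ν'` for all real `t > 0` (principal complex powers), then `ν = ν'`: evaluate
at `t = e` and `t = e^{√2}` and use the `2πi`-periodicity of `exp` together with the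
irrationality of `√2`. Tate, Corvallis 1979, §3 (the quasi-characters `‖·‖^ν` of `ℝ_{>0}` are
pairwise distinct). [folklore] -/
theorem cpow_exponent_unique {ν ν' : ℂ} (h : ∀ t : ℝ, 0 < t → ((t : ℂ) ^ ν) = (t : ℂ) ^ ν') :
    ν = ν' := by
  have key : ∀ u : ℝ, Complex.exp ((u : ℂ) * ν) = Complex.exp ((u : ℂ) * ν') := by
    intro u
    have ht := h (Real.exp u) (Real.exp_pos u)
    have hne : Complex.exp (u : ℂ) ≠ 0 := Complex.exp_ne_zero _
    have hlog : Complex.log (Complex.exp (u : ℂ)) = u :=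
      Complex.log_exp (by simp [Real.pi_pos]) (by simp [Real.pi_pos.le])
    rwa [Complex.ofReal_exp, Complex.cpow_def_of_ne_zero hne, Complex.cpow_def_of_ne_zero hne,
      hlog] at ht
  obtain ⟨n, hn⟩ := Complex.exp_eq_exp_iff_exists_int.mp (key 1)
  obtain ⟨m, hm⟩ := Complex.exp_eq_exp_iff_exists_int.mp (key (Real.sqrt 2))
  have e1 : ν - ν' = n * (2 * Real.pi * I) := by
    push_cast at hn
    linear_combination hn
  have e2 : (Real.sqrt 2 : ℂ) * (ν - ν') = m * (2 * Real.pi * I) := by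
    linear_combination hm
  have hπ : (2 * Real.pi * I : ℂ) ≠ 0 := by simp [Real.pi_ne_zero, Complex.I_ne_zero]
  have h2 : (Real.sqrt 2 : ℂ) * n = m := by
    rw [e1, ← mul_assoc] at e2
    exact mul_right_cancel₀ hπ e2
  have h3 : Real.sqrt 2 * n = m := by exact_mod_cast h2
  by_cases hn0 : n = 0
  · subst hn0
    exact sub_eq_zero.mp (by simpa using e1)
  · exfalso
    have hq : Real.sqrt 2 = m / n := by
      rw [eq_div_iff (Int.cast_ne_zero.mpr hn0)]
      exact h3
    exact (irrational_iff_ne_rational _).mp irrational_sqrt_two m n hn0 hq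

/-- If `e^{ikθ} = e^{ik'θ}` for all real `θ`, then `k = k'` (`k, k' ∈ ℤ`): evaluate at
`θ = 2π / N` with `N > |k - k'|`. Tate, Corvallis 1979, §3 (the characters `θ ↦ e^{ikθ}` of the
circle are pairwise distinct). [folklore] -/
theorem circle_exponent_unique {k k' : ℤ}
    (h : ∀ θ : ℝ, Complex.exp (θ * I) ^ k = Complex.exp (θ * I) ^ k') : k = k' := by
  set N : ℕ := (k - k').natAbs + 1 with hN
  have hNpos : (0 : ℝ) < N := by positivity
  have hNne : (N : ℂ) ≠ 0 := by exact_mod_cast hNpos.ne'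
  have hθ := h (2 * Real.pi / N)
  rw [← Complex.exp_int_mul, ← Complex.exp_int_mul] at hθ
  obtain ⟨n, hn⟩ := Complex.exp_eq_exp_iff_exists_int.mp hθ
  have hπ : (2 * Real.pi * I : ℂ) ≠ 0 := by simp [Real.pi_ne_zero, Complex.I_ne_zero]
  -- `(k - k') · 2πi / N = n · 2πi`, hence `k - k' = n N`
  have e1 : ((k : ℂ) - k') * (2 * Real.pi * I) = (n * N : ℂ) * (2 * Real.pi * I) := by
    have : ((k : ℂ) - k') * (2 * Real.pi * I) =
        (N : ℂ) * ((k : ℂ) * (((2 * Real.pi / N : ℝ) : ℂ) * I) -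
          (k' : ℂ) * (((2 * Real.pi / N : ℝ) : ℂ) * I)) := by
      push_cast
      field_simp
    rw [this, hn]
    push_cast
    field_simp
    ring
  have e2 : (k : ℂ) - k' = n * N := mul_right_cancel₀ hπ e1
  have e3 : k - k' = n * N := by exact_mod_cast e2
  by_contra hne
  have hn0 : n ≠ 0 := by
    rintro rfl
    apply hne
    simpa [sub_eq_zero] using e3
  have : ((k - k').natAbs : ℤ) < N := by simp [hN]
  have habs : (k - k').natAbs = n.natAbs * N := by
    rw [e3, Int.natAbs_mul, Int.natAbs_natCast]
  have : (N : ℤ) ≤ (k - k').natAbs := by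
    rw [habs]
    push_cast
    have h1 : (1 : ℤ) ≤ |n| := Int.one_le_abs hn0
    have h2 : (0 : ℤ) < N := by rw [hN]; positivity
    nlinarith
  omega

/-! ### Uniqueness of the Booker–Krishnamurthy parameters -/

section Unique

variable {K : Type u} [Field K] [NumberField K]

omit [NumberField K] in
/-- At a real place `w`, an element of `F_wˣ` with prescribed image `t ≠ 0` in `ℝ`
(`extensionEmbeddingOfIsReal` is bijective). [folklore] -/
private theorem exists_unit_of_isReal {w : InfinitePlace K} (hw : w.IsReal) {t : ℝ} (ht : t ≠ 0) :
    ∃ y : (w.Completion)ˣ, Completion.extensionEmbeddingOfIsReal hw (y : w.Completion) = t ∧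
      ‖(y : w.Completion)‖ = |t| := by
  obtain ⟨x, hx⟩ := Completion.surjective_extensionEmbeddingOfIsReal hw t
  have hx0 : x ≠ 0 := by
    rintro rfl
    exact ht (by simpa using hx.symm)
  refine ⟨Units.mk0 x hx0, by simpa using hx, ?_⟩
  have := (AddMonoidHomClass.isometry_iff_norm _).1
    (Completion.isometry_extensionEmbeddingOfIsReal hw) x
  rw [Units.val_mk0, ← this, hx, Real.norm_eq_abs]

omit [NumberField K] in
/-- At a complex place `w`, an element of `F_wˣ` with prescribed image `z ≠ 0` in `ℂ`
(`extensionEmbedding` is bijective at a complex place). [folklore] -/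
private theorem exists_unit_of_isComplex {w : InfinitePlace K} (hw : w.IsComplex) {z : ℂ}
    (hz : z ≠ 0) :
    ∃ y : (w.Completion)ˣ, Completion.extensionEmbedding w (y : w.Completion) = z ∧
      ‖(y : w.Completion)‖ = ‖z‖ := by
  obtain ⟨x, hx⟩ := Completion.surjective_extensionEmbedding_of_isComplex hw z
  have hx0 : x ≠ 0 := by
    rintro rfl
    exact hz (by simpa using hx.symm)
  refine ⟨Units.mk0 x hx0, by simpa using hx, ?_⟩
  have := (AddMonoidHomClass.isometry_iff_norm _).1 (Completion.isometry_extensionEmbedding w) x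
  rw [Units.val_mk0, ← this, hx]

omit [NumberField K] in
/-- **Uniqueness of the parameters `(ν, ε)` of a character of `F_wˣ` at a real place**
(Booker–Krishnamurthy 2011, §1.1, p. 672: "`χ_v` may be written uniquely in the form
`χ_v(y) = ‖y‖_v^{ν(χ_v)} sgn_v(y)^{ε(χ_v)}`"): compare at the positive reals (`ν`, by
`cpow_exponent_unique`) and at `y = -1` (`ε`). [cite: BookerKrishnamurthy2011, §1.1 (p. 672)] -/
theorem HasRealParam.unique {w : InfinitePlace K} {hw : w.IsReal} {χ : (w.Completion)ˣ →* ℂˣ}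
    {ν ν' : ℂ} {ε ε' : Fin 2} (h : HasRealParam hw χ ν ε) (h' : HasRealParam hw χ ν' ε') :
    ν = ν' ∧ ε = ε' := by
  have hν : ν = ν' := by
    refine cpow_exponent_unique fun t ht => ?_
    obtain ⟨y, hy, hnorm⟩ := exists_unit_of_isReal hw ht.ne'
    have h1 := h y
    have h2 := h' y
    rw [hy, hnorm, abs_of_pos ht, sign_pos ht] at h1 h2
    simp only [SignType.coe_one, one_pow, mul_one] at h1 h2
    rw [← h1, ← h2]
  refine ⟨hν, ?_⟩
  subst hν
  obtain ⟨y, hy, hnorm⟩ := exists_unit_of_isReal hw (neg_ne_zero.mpr one_ne_zero : (-1 : ℝ) ≠ 0)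
  have h1 := h y
  have h2 := h' y
  rw [hy, hnorm] at h1 h2
  have hs : SignType.sign (-1 : ℝ) = -1 := sign_neg (by norm_num)
  rw [hs] at h1 h2
  simp only [abs_neg, abs_one, Complex.ofReal_one, Complex.one_cpow, one_mul,
    SignType.coe_neg_one] at h1 h2
  rw [h1] at h2
  -- `(-1)^ε = (-1)^ε'` with `ε, ε' ∈ {0, 1}`
  revert h2
  fin_cases ε <;> fin_cases ε' <;> norm_num

omit [NumberField K] in
/-- **Uniqueness of the parameters `(ν, k)` of a character of `F_wˣ` at a complex place**
(Booker–Krishnamurthy 2011, §1.1, p. 672: "for `v ∈ S_ℂ`, we have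
`χ_v(y) = ‖y‖_v^{ν(χ_v)} θ_v(y)^{k(χ_v)}`, where `θ_v(y) = y‖y‖_v^{-1/2}`, `ν(χ_v) ∈ ℂ` and
`k(χ_v) ∈ ℤ`", uniquely): compare at the positive reals (`ν`) and on the unit circle (`k`, by
`circle_exponent_unique`). [cite: BookerKrishnamurthy2011, §1.1 (p. 672)] -/
theorem HasComplexParam.unique {w : InfinitePlace K} (hw : w.IsComplex)
    {χ : (w.Completion)ˣ →* ℂˣ} {ν ν' : ℂ} {k k' : ℤ} (h : HasComplexParam χ ν k)
    (h' : HasComplexParam χ ν' k') : ν = ν' ∧ k = k' := by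
  have hν : ν = ν' := by
    refine cpow_exponent_unique fun t ht => ?_
    have hst : (0 : ℝ) < Real.sqrt t := Real.sqrt_pos.mpr ht
    obtain ⟨y, hy, hnorm⟩ :=
      exists_unit_of_isComplex hw (by exact_mod_cast hst.ne' : ((Real.sqrt t : ℝ) : ℂ) ≠ 0)
    have h1 := h y
    have h2 := h' y
    have hn : ‖(y : w.Completion)‖ = Real.sqrt t := by
      rw [hnorm, Complex.norm_real, Real.norm_eq_abs, abs_of_pos hst]
    have hq : Completion.extensionEmbedding w (y : w.Completion) / (‖(y : w.Completion)‖ : ℂ)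
        = 1 := by
      rw [hy, hn, div_self (by exact_mod_cast hst.ne')]
    rw [hq, hn, Real.sq_sqrt ht.le] at h1 h2
    simp only [one_zpow, mul_one] at h1 h2
    rw [← h1, ← h2]
  refine ⟨hν, ?_⟩
  subst hν
  refine circle_exponent_unique fun θ => ?_
  have hz : Complex.exp (θ * I) ≠ 0 := Complex.exp_ne_zero _
  obtain ⟨y, hy, hnorm⟩ := exists_unit_of_isComplex hw hz
  have h1 := h y
  have h2 := h' y
  have hn : ‖(y : w.Completion)‖ = 1 := by
    rw [hnorm, Complex.norm_exp_ofReal_mul_I]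
  rw [hy, hn] at h1 h2
  simp only [one_pow, Complex.ofReal_one, Complex.one_cpow, one_mul, div_one] at h1 h2
  rw [← h1, ← h2]

/-- **`Λ(s, σ ⊗ ω)` does not depend on the choice of the parameter family — archimedean part.**
If `P` and `P'` are both archimedean parameters of the idèle class character `ω`
(`ω.HasArchParams P`, `ω.HasArchParams P'`), then `artinTwistGammaFactor σ P =
artinTwistGammaFactor σ P'`: the factor reads only `(ν_w, ε_w)` at the real places and
`(ν_w, k_w)` at the complex places, which are determined by `ω_w` (`HasRealParam.unique`,
`HasComplexParam.unique`). Booker–Krishnamurthy 2011, §1.1 (p. 672) with §4.2 (pp. 683–685).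
[cite: BookerKrishnamurthy2011, §1.1 (p. 672)] -/
theorem artinTwistGammaFactor_congr {V : Type*} [AddCommGroup V] [Module ℂ V]
    [TopologicalSpace V] [FiniteDimensional ℂ V] (σ : ArtinRep K V) {ω : HeckeCharacter K}
    {P P' : ArchParams K} (hP : ω.HasArchParams P) (hP' : ω.HasArchParams P') :
    artinTwistGammaFactor σ P = artinTwistGammaFactor σ P' := by
  funext s
  unfold artinTwistGammaFactor
  refine Finset.prod_congr rfl fun w _ => ?_
  by_cases hw : w.IsReal
  · obtain ⟨hν, hε⟩ := ((hP w).1 hw).unique ((hP' w).1 hw)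
    rw [dif_pos hw, dif_pos hw, hν, hε]
  · have hc : w.IsComplex := not_isReal_iff_isComplex.mp hw
    obtain ⟨hν, hk⟩ := HasComplexParam.unique hc ((hP w).2 hc) ((hP' w).2 hc)
    rw [dif_neg hw, dif_neg hw, hν, hk]

/-- **`Λ(s, σ ⊗ ω)` does not depend on the choice of the parameter family.** For two families
`P`, `P'` of archimedean parameters of the same `ω`,
`artinTwistCompletedL σ P ω = artinTwistCompletedL σ P' ω`. Booker–Krishnamurthy 2011, §1.1
(uniqueness of the parameters) and Thm. 1.1 (definition of `Λ(s, π ⊗ ω)`).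
[cite: BookerKrishnamurthy2011, §1.1 (p. 672)] -/
theorem artinTwistCompletedL_congr {V : Type*} [AddCommGroup V] [Module ℂ V]
    [TopologicalSpace V] [FiniteDimensional ℂ V] (σ : ArtinRep K V) {ω : HeckeCharacter K}
    {P P' : ArchParams K} (hP : ω.HasArchParams P) (hP' : ω.HasArchParams P') :
    artinTwistCompletedL σ P ω = artinTwistCompletedL σ P' ω := by
  funext s
  rw [artinTwistCompletedL, artinTwistCompletedL, artinTwistGammaFactor_congr σ hP hP']

/-- Consequence for the hypothesis of `bookerKrishnamurthy_isPiOfArtinRep_of_entire_twists`: for a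
fixed `ω`, the clause "`Λ(s, σ ⊗ ω)` is entire for EVERY parameter family `P` of `ω`" already
follows from its truth for ONE parameter family (so the universal quantifier over `P` in the
named fact does not strengthen the printed hypothesis "`Λ(s, ρ ⊗ ω)` is entire").
[cite: BookerKrishnamurthy2011, Cor. 1.2 (p. 670)] -/
theorem hasEntireContinuation_forall_of_exists {V : Type*} [AddCommGroup V] [Module ℂ V]
    [TopologicalSpace V] [FiniteDimensional ℂ V] (σ : ArtinRep K V) {ω : HeckeCharacter K}
    (h : ∃ P : ArchParams K, ω.HasArchParams P ∧
      LFunction.HasEntireContinuation (artinTwistCompletedL σ P ω)) :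
    ∀ P : ArchParams K, ω.HasArchParams P →
      LFunction.HasEntireContinuation (artinTwistCompletedL σ P ω) := by
  obtain ⟨P₀, hP₀, hE⟩ := h
  intro P hP
  rwa [artinTwistCompletedL_congr σ hP hP₀]

end Unique

/-! ### Convergence of the twisted Euler product on `re s > 1` -/

section Convergence

variable {K : Type u} [Field K] [NumberField K] {V : Type*} [AddCommGroup V] [Module ℂ V]
  [TopologicalSpace V] [FiniteDimensional ℂ V]

/-- **Local estimate for the twisted Euler factor.** For an Artin representation `σ` with finite
image, a finite place `v`, `re s ≥ 0` and a local parameter `c` with `‖c‖ ≤ 1` (e.g.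
`c = ω_v(ϖ_v)` for a unitary `ω`): `‖det(1 - c q_v^{-s} Frob_v | V^{I_v}) - 1‖ ≤
(2^{dim V} - 1) q_v^{-re s}`, since the Euler factor is `∏_{i ≤ dim V} (1 - β_i T)` with
`|β_i| = 1` (`ArtinRep.exists_card_le_eval_eulerFactorAt_eq_prod`). Neukirch, *Algebraic Number
Theory*, Ch. VII §10, remark after (10.1). [cite: NeukirchANT1999, Ch. VII §10, (10.1)] -/
theorem norm_eval_eulerFactorAt_twist_sub_one_le (σ : ArtinRep K V)
    (hfin : (Set.range (σ : Field.absoluteGaloisGroup K → V →ₗ[ℂ] V)).Finite)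
    (v : HeightOneSpectrum (𝓞 K)) {c : ℂ} (hc : ‖c‖ ≤ 1) {s : ℂ} (hs : 0 ≤ s.re) :
    ‖(σ.eulerFactorAt v).eval (c * (v.residueCard : ℂ) ^ (-s)) - 1‖ ≤
      (2 ^ Module.finrank ℂ V - 1) * (v.residueCard : ℝ) ^ (-s.re) := by
  obtain ⟨B, hcard, hnorm, heval⟩ := σ.exists_card_le_eval_eulerFactorAt_eq_prod hfin v
  have hq : 1 < v.residueCard := v.one_lt_residueCard
  have hq0 : 0 < v.residueCard := Nat.zero_lt_of_lt hq
  have hx : ‖c * (v.residueCard : ℂ) ^ (-s)‖ ≤ (v.residueCard : ℝ) ^ (-s.re) := by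
    rw [norm_mul, Complex.norm_natCast_cpow_of_pos hq0, Complex.neg_re]
    calc ‖c‖ * (v.residueCard : ℝ) ^ (-s.re) ≤ 1 * (v.residueCard : ℝ) ^ (-s.re) := by
          gcongr
      _ = (v.residueCard : ℝ) ^ (-s.re) := one_mul _
  have hBt : 1 * (v.residueCard : ℝ) ^ (-s.re) ≤ 1 := by
    rw [one_mul]
    exact Real.rpow_le_one_of_one_le_of_nonpos (by exact_mod_cast hq.le) (by linarith)
  have h := (Automorphic.norm_eval_eulerPolynomial_sub_one_le zero_le_one hx hBt B
    fun a ha => (hnorm a ha).le).1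
  rw [Automorphic.eval_eulerPolynomial, ← heval, one_mul] at h
  refine h.trans ?_
  have hpos : 0 ≤ (v.residueCard : ℝ) ^ (-s.re) := Real.rpow_nonneg (Nat.cast_nonneg _) _
  have h2 : (2 : ℝ) ^ Multiset.card B ≤ 2 ^ Module.finrank ℂ V :=
    pow_le_pow_right₀ one_le_two hcard
  gcongr

/-- A unitary idèle class character has `|ω_v(ϖ_v)| = 1` at every finite place. [folklore] -/
theorem _root_.Literature.NumberTheory.GaloisRepresentations.HeckeCharacter.IsUnitary.norm_valueAtUniformizer
    {ω : HeckeCharacter K} (hω : ω.IsUnitary) (v : HeightOneSpectrum (𝓞 K)) :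
    ‖ω.valueAtUniformizer v‖ = 1 :=
  hω _

/-- **Convergence of the twisted Euler product `L(s, σ ⊗ ω)` for `re s > 1`** (hypothesis (i) of
Booker–Krishnamurthy 2011, Thm. 1.1, for the Weil-group `L`-function `Λ(s, ρ ⊗ ω)` of Cor. 1.2,
with `σ = 1`): for an Artin representation `σ` on a finite-dimensional `V` with its module
topology, a UNITARY idèle class character `ω` and `re s > 1`, the product
`∏_v det(1 - ω_v(ϖ_v) q_v^{-s} Frob_v | V^{I_v})⁻¹` defining `artinTwistLFunction σ ω s` is
multipliable: the image of `σ` is finite (`ArtinRep.finite_range_holds`), `|ω_v(ϖ_v)| = 1`, so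
`‖E_v - 1‖ ≤ (2^{dim V} - 1) q_v^{-re s}` (`norm_eval_eulerFactorAt_twist_sub_one_le`), summable
over `v` (`Automorphic.summable_residueCard_rpow_neg`), and an absolutely convergent product
converges (`Automorphic.summable_norm_inv_sub_one`, Mathlib `multipliable_one_add_of_summable`)
— verbatim the argument of `multipliable_artinLFunction_holds` (Neukirch VII §10).
[cite: BookerKrishnamurthy2011, Thm. 1.1 (i) (p. 670)] [cite: NeukirchANT1999, Ch. VII §10, (10.1)] -/
theorem multipliable_artinTwistLFunction [IsModuleTopology ℂ V] (σ : ArtinRep K V)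
    {ω : HeckeCharacter K} (hω : ω.IsUnitary) {s : ℂ} (hs : 1 < s.re) :
    Multipliable fun v : HeightOneSpectrum (𝓞 K) =>
      ((σ.eulerFactorAt v).eval (ω.valueAtUniformizer v * (v.residueCard : ℂ) ^ (-s)))⁻¹ := by
  have hfin : (Set.range (σ : Field.absoluteGaloisGroup K → V →ₗ[ℂ] V)).Finite :=
    ArtinRep.finite_range_holds σ
  have hb : Summable fun v : HeightOneSpectrum (𝓞 K) =>
      (2 ^ Module.finrank ℂ V - 1) * (v.residueCard : ℝ) ^ (-s.re) :=
    (Automorphic.summable_residueCard_rpow_neg hs).mul_left _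
  have hsum := Automorphic.summable_norm_inv_sub_one hb fun v =>
    norm_eval_eulerFactorAt_twist_sub_one_le σ hfin v (hω.norm_valueAtUniformizer v).le
      (by linarith)
  simpa only [add_sub_cancel] using multipliable_one_add_of_summable hsum

/-- For unitary `ω` and `re s > 1`, `artinTwistLFunction σ ω s` (a `tprod`) IS the value of the
convergent twisted Euler product (`HasProd`). [cite: BookerKrishnamurthy2011, Thm. 1.1 (i) (p. 670)] -/
theorem hasProd_artinTwistLFunction [IsModuleTopology ℂ V] (σ : ArtinRep K V)
    {ω : HeckeCharacter K} (hω : ω.IsUnitary) {s : ℂ} (hs : 1 < s.re) :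
    HasProd (fun v : HeightOneSpectrum (𝓞 K) =>
      ((σ.eulerFactorAt v).eval (ω.valueAtUniformizer v * (v.residueCard : ℂ) ^ (-s)))⁻¹)
      (artinTwistLFunction σ ω s) :=
  (multipliable_artinTwistLFunction σ hω hs).hasProd

end Convergence

/-! ### Existence of the Booker–Krishnamurthy parameters -/

section Existence

variable {K : Type u} [Field K] [NumberField K]

/-- **The archimedean components of an idèle class character are continuous**: `ω_w = ω ∘ i_w`
with `i_w : F_wˣ → 𝕀_F` the continuous inclusion (`Units.map` of `x ↦ (x, 1)` and of
`Pi.mulSingle w`). Tate's thesis, §4.3 (local components of a quasi-character of the idèle class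
group). [cite: TateThesis1967, §4.3] -/
theorem _root_.Literature.NumberTheory.GaloisRepresentations.HeckeCharacter.continuous_archComponent
    (ω : HeckeCharacter K) (w : InfinitePlace K) : Continuous (ω.archComponent w) := by
  classical
  have h1 : Continuous (infiniteIdeles K : (InfiniteAdeleRing K)ˣ → ideleGroup K) :=
    Continuous.units_map _ (continuous_id.prodMk continuous_const)
  have h2 : Continuous (Units.map (MonoidHom.mulSingle (fun v : InfinitePlace K => v.Completion) w :
      w.Completion →* InfiniteAdeleRing K) : (w.Completion)ˣ → (InfiniteAdeleRing K)ˣ) :=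
    Continuous.units_map _ (continuous_mulSingle (A := fun v : InfinitePlace K => v.Completion) w)
  exact (map_continuous ω).comp (h1.comp h2)

omit [NumberField K] in
/-- **Radial part at a real place**: for a continuous quasi-character `χ` of `F_wˣ`, `w` real,
there is `ν ∈ ℂ` with `χ(y) = t^ν` whenever `y ↦ t > 0` under `F_w ≅ ℝ` (the one-parameter group
`s ↦ χ(e^s)` is `e^{νs}`, `exists_eq_exp_mul_of_continuous_hom`). Tate, Corvallis 1979, §3;
Booker–Krishnamurthy 2011, §1.1 (p. 672). [cite: BookerKrishnamurthy2011, §1.1 (p. 672)] -/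
theorem exists_cpow_of_continuous_isReal {w : InfinitePlace K} (hw : w.IsReal)
    {χ : (w.Completion)ˣ →* ℂˣ} (hχ : Continuous χ) :
    ∃ ν : ℂ, ∀ (y : (w.Completion)ˣ) (t : ℝ), 0 < t →
      Completion.extensionEmbeddingOfIsReal hw (y : w.Completion) = t → (χ y : ℂ) = (t : ℂ) ^ ν := by
  set e := Completion.ringEquivRealOfIsReal hw with he
  have hsymm_cont : Continuous e.symm := (Completion.isometryEquivRealOfIsReal hw).symm.continuous
  have hne : ∀ s : ℝ, e.symm (Real.exp s) ≠ 0 := fun s =>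
    (RingEquiv.map_ne_zero_iff _).mpr (Real.exp_ne_zero s)
  set u : ℝ → (w.Completion)ˣ := fun s => Units.mk0 (e.symm (Real.exp s)) (hne s) with hu
  have hu_cont : Continuous u := by
    refine Units.continuous_iff.mpr ⟨hsymm_cont.comp Real.continuous_exp, ?_⟩
    simp only [hu, Units.val_inv_eq_inv_val, Units.val_mk0]
    exact (hsymm_cont.comp Real.continuous_exp).inv₀ fun s => hne s
  have hu_add : ∀ s t, u (s + t) = u s * u t := fun s t => by
    apply Units.ext
    simp only [hu, Units.val_mk0, Units.val_mul, ← map_mul, Real.exp_add]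
  set f : ℝ → ℂ := fun s => (χ (u s) : ℂ) with hf
  have hf_cont : Continuous f := Units.continuous_val.comp (hχ.comp hu_cont)
  have hf0 : ∀ s, f s ≠ 0 := fun s => Units.ne_zero _
  have hf_add : ∀ s t, f (s + t) = f s * f t := fun s t => by
    simp only [hf, hu_add, map_mul, Units.val_mul]
  obtain ⟨μ, hμ⟩ := exists_eq_exp_mul_of_continuous_hom hf_cont hf0 hf_add
  refine ⟨μ, fun y t ht hy => ?_⟩
  have hyu : y = u (Real.log t) := by
    apply Units.ext
    simp only [hu, Units.val_mk0, Real.exp_log ht]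
    apply e.injective
    rw [RingEquiv.apply_symm_apply, he, Completion.ringEquivRealOfIsReal_apply]
    exact hy
  rw [hyu]
  change f (Real.log t) = _
  rw [hμ, Complex.cpow_def_of_ne_zero (by exact_mod_cast ht.ne'), ← Complex.ofReal_log ht.le,
    mul_comm]

omit [NumberField K] in
/-- **Existence of the parameters `(ν, ε)` at a real place** (Booker–Krishnamurthy 2011, §1.1,
p. 672: "for `v ∈ S_ℝ`, `χ_v` may be written uniquely in the form
`χ_v(y) = ‖y‖_v^{ν(χ_v)} sgn_v(y)^{ε(χ_v)}`"), for every CONTINUOUS quasi-character `χ` of `F_wˣ`: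
`ν` from the radial part (`exists_cpow_of_continuous_isReal`) and `ε ∈ {0, 1}` from
`χ(-1) = ±1`. [cite: BookerKrishnamurthy2011, §1.1 (p. 672)] -/
theorem exists_hasRealParam_of_continuous {w : InfinitePlace K} (hw : w.IsReal)
    {χ : (w.Completion)ˣ →* ℂˣ} (hχ : Continuous χ) :
    ∃ (ν : ℂ) (ε : Fin 2), HasRealParam hw χ ν ε := by
  obtain ⟨ν, hν⟩ := exists_cpow_of_continuous_isReal hw hχ
  set e := Completion.ringEquivRealOfIsReal hw with he
  have key : ∀ x, Completion.extensionEmbeddingOfIsReal hw (e.symm x) = x := fun x => by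
    rw [← Completion.ringEquivRealOfIsReal_apply hw, RingEquiv.apply_symm_apply]
  -- the unit `m ↦ -1`
  have hm0 : e.symm (-1) ≠ 0 := (RingEquiv.map_ne_zero_iff _).mpr (by norm_num)
  set m : (w.Completion)ˣ := Units.mk0 (e.symm (-1)) hm0 with hm
  have hm2 : m * m = 1 := by
    apply Units.ext
    simp only [hm, Units.val_mul, Units.val_mk0, Units.val_one, ← map_mul]
    norm_num
  have hminv : m⁻¹ = m := inv_eq_of_mul_eq_one_right hm2
  have hχm : (χ m : ℂ) = 1 ∨ (χ m : ℂ) = -1 := by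
    have : (χ m : ℂ) * χ m = 1 := by
      rw [← Units.val_mul, ← map_mul, hm2, map_one, Units.val_one]
    exact mul_self_eq_one_iff.mp this
  obtain ⟨ε, hε⟩ : ∃ ε : Fin 2, (-1 : ℂ) ^ (ε : ℕ) = (χ m : ℂ) := by
    rcases hχm with h | h
    · exact ⟨0, by simp [h]⟩
    · exact ⟨1, by simp [h]⟩
  refine ⟨ν, ε, fun y => ?_⟩
  set t := Completion.extensionEmbeddingOfIsReal hw (y : w.Completion) with ht
  have ht0 : t ≠ 0 := fun h =>
    y.ne_zero ((map_eq_zero_iff _ (Completion.extensionEmbeddingOfIsReal hw).injective).mp h)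
  have hnorm : ‖(y : w.Completion)‖ = |t| := by
    rw [ht, ← Real.norm_eq_abs]
    exact ((AddMonoidHomClass.isometry_iff_norm _).1
      (Completion.isometry_extensionEmbeddingOfIsReal hw) _).symm
  rcases lt_or_gt_of_ne ht0 with hneg | hpos
  · -- `t < 0`: `y = m · y'` with `y' ↦ -t > 0`
    have hy' : Completion.extensionEmbeddingOfIsReal hw ((m⁻¹ * y : (w.Completion)ˣ) : w.Completion)
        = -t := by
      rw [hminv, Units.val_mul, map_mul, hm, Units.val_mk0, key, ← ht]
      ring
    have h1 := hν (m⁻¹ * y) (-t) (by linarith) hy'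
    have h2 : (χ y : ℂ) = χ m * χ (m⁻¹ * y) := by
      rw [← Units.val_mul, ← map_mul, mul_inv_cancel_left]
    have hs : ((SignType.sign t : SignType) : ℂ) = -1 := by rw [sign_neg hneg]; simp
    rw [h2, h1, hnorm, abs_of_neg hneg, hs, ← hε]
    push_cast
    ring
  · have h1 := hν y t hpos rfl
    rw [h1, hnorm, abs_of_pos hpos, sign_pos hpos]
    simp

omit [NumberField K] in
/-- **Existence of the parameters `(ν, k)` at a complex place** (Booker–Krishnamurthy 2011,
§1.1, p. 672: "for `v ∈ S_ℂ`, we have `χ_v(y) = ‖y‖_v^{ν(χ_v)} θ_v(y)^{k(χ_v)}`, where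
`θ_v(y) = y‖y‖_v^{-1/2}`, `ν(χ_v) ∈ ℂ` and `k(χ_v) ∈ ℤ`"), for every CONTINUOUS quasi-character
`χ` of `F_wˣ`: polar decomposition `z = |z| e^{iθ}` under `F_w ≅ ℂ`; the radial one-parameter
group `s ↦ χ(e^s)` is `e^{μ s}` (`ν = μ/2` since `‖·‖_v = |·|²`), the angular one `θ ↦ χ(e^{iθ})`
is `e^{μ'θ}` and `2π`-periodic, whence `μ' = ik`, `k ∈ ℤ`. [cite: BookerKrishnamurthy2011, §1.1 (p. 672)] -/
theorem exists_hasComplexParam_of_continuous {w : InfinitePlace K} (hw : w.IsComplex)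
    {χ : (w.Completion)ˣ →* ℂˣ} (hχ : Continuous χ) :
    ∃ (ν : ℂ) (k : ℤ), HasComplexParam χ ν k := by
  set e := Completion.ringEquivComplexOfIsComplex hw with he
  have hsymm_cont : Continuous e.symm :=
    (Completion.isometryEquivComplexOfIsComplex hw).symm.continuous
  have key : ∀ z, Completion.extensionEmbedding w (e.symm z) = z := fun z => by
    rw [← Completion.ringEquivComplexOfIsComplex_apply hw, RingEquiv.apply_symm_apply]
  have hne : ∀ z : ℂ, z ≠ 0 → e.symm z ≠ 0 := fun z hz => (RingEquiv.map_ne_zero_iff _).mpr hz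
  -- radial one-parameter group
  have hner : ∀ s : ℝ, ((Real.exp s : ℝ) : ℂ) ≠ 0 := fun s => by exact_mod_cast Real.exp_ne_zero s
  set ur : ℝ → (w.Completion)ˣ := fun s => Units.mk0 (e.symm (Real.exp s : ℝ)) (hne _ (hner s))
    with hur
  have hur_val_cont : Continuous fun s : ℝ => e.symm ((Real.exp s : ℝ) : ℂ) :=
    hsymm_cont.comp (Complex.continuous_ofReal.comp Real.continuous_exp)
  have hur_cont : Continuous ur := by
    refine Units.continuous_iff.mpr ⟨hur_val_cont, ?_⟩
    simp only [hur, Units.val_inv_eq_inv_val, Units.val_mk0]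
    exact hur_val_cont.inv₀ fun s => hne _ (hner s)
  have hur_add : ∀ s t, ur (s + t) = ur s * ur t := fun s t => by
    apply Units.ext
    simp only [hur, Units.val_mk0, Units.val_mul, ← map_mul, Real.exp_add, Complex.ofReal_mul]
  -- angular one-parameter group
  have hnea : ∀ θ : ℝ, Complex.exp (θ * I) ≠ 0 := fun θ => Complex.exp_ne_zero _
  set ua : ℝ → (w.Completion)ˣ := fun θ => Units.mk0 (e.symm (Complex.exp (θ * I))) (hne _ (hnea θ))
    with hua
  have hua_val_cont : Continuous fun θ : ℝ => e.symm (Complex.exp (θ * I)) :=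
    hsymm_cont.comp (Complex.continuous_exp.comp (Complex.continuous_ofReal.mul continuous_const))
  have hua_cont : Continuous ua := by
    refine Units.continuous_iff.mpr ⟨hua_val_cont, ?_⟩
    simp only [hua, Units.val_inv_eq_inv_val, Units.val_mk0]
    exact hua_val_cont.inv₀ fun θ => hne _ (hnea θ)
  have hua_add : ∀ s t, ua (s + t) = ua s * ua t := fun s t => by
    apply Units.ext
    simp only [hua, Units.val_mk0, Units.val_mul, ← map_mul, ← Complex.exp_add]
    congr 2
    push_cast
    ring
  -- the two exponents
  obtain ⟨μ, hμ⟩ := exists_eq_exp_mul_of_continuous_hom (f := fun s => (χ (ur s) : ℂ))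
    (by exact Units.continuous_val.comp (hχ.comp hur_cont)) (fun s => Units.ne_zero _)
    (fun s t => by simp only [hur_add, map_mul, Units.val_mul])
  obtain ⟨μ', hμ'⟩ := exists_eq_exp_mul_of_continuous_hom (f := fun θ => (χ (ua θ) : ℂ))
    (by exact Units.continuous_val.comp (hχ.comp hua_cont)) (fun s => Units.ne_zero _)
    (fun s t => by simp only [hua_add, map_mul, Units.val_mul])
  -- periodicity of the angular group: `μ' = ik`
  have hua2π : ua (2 * Real.pi) = 1 := by
    apply Units.ext
    simp only [hua, Units.val_mk0, Units.val_one]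
    rw [show ((2 * Real.pi : ℝ) : ℂ) * I = 2 * Real.pi * I by push_cast; ring,
      Complex.exp_two_pi_mul_I, map_one]
  have h2π : Complex.exp (μ' * (2 * Real.pi : ℝ)) = 1 := by
    have := hμ' (2 * Real.pi)
    simp only [hua2π, map_one, Units.val_one] at this
    exact this.symm
  obtain ⟨k, hk⟩ := Complex.exp_eq_one_iff.mp h2π
  have hμ'k : μ' = k * I := by
    have hπ : ((2 * Real.pi : ℝ) : ℂ) ≠ 0 := by exact_mod_cast (by positivity : (0:ℝ) < 2 * Real.pi).ne'
    have : μ' * ((2 * Real.pi : ℝ) : ℂ) = (k * I) * ((2 * Real.pi : ℝ) : ℂ) := by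
      rw [hk]; push_cast; ring
    exact mul_right_cancel₀ hπ this
  refine ⟨μ / 2, k, fun y => ?_⟩
  set z := Completion.extensionEmbedding w (y : w.Completion) with hz
  have hz0 : z ≠ 0 := fun h =>
    y.ne_zero ((map_eq_zero_iff _ (Completion.extensionEmbedding w).injective).mp h)
  have hnorm : ‖(y : w.Completion)‖ = ‖z‖ := by
    rw [hz]
    exact ((AddMonoidHomClass.isometry_iff_norm _).1 (Completion.isometry_extensionEmbedding w) _).symm
  have hnz : (0 : ℝ) < ‖z‖ := norm_pos_iff.mpr hz0
  have hnzC : ((‖z‖ : ℝ) : ℂ) ≠ 0 := by exact_mod_cast hnz.ne'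
  -- polar decomposition of `y`
  have hy : y = ur (Real.log ‖z‖) * ua (Complex.arg z) := by
    apply Units.ext
    apply e.injective
    simp only [Units.val_mul, map_mul, hur, hua, Units.val_mk0, RingEquiv.apply_symm_apply,
      Real.exp_log hnz]
    rw [Complex.norm_mul_exp_arg_mul_I, he, Completion.ringEquivComplexOfIsComplex_apply]
  have hθ : z / (‖z‖ : ℂ) = Complex.exp (Complex.arg z * I) := by
    rw [div_eq_iff hnzC, mul_comm]
    exact (Complex.norm_mul_exp_arg_mul_I z).symm
  have hχy : (χ y : ℂ) = χ (ur (Real.log ‖z‖)) * χ (ua (Complex.arg z)) := by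
    rw [hy, map_mul, Units.val_mul]
  have e1 : (χ (ur (Real.log ‖z‖)) : ℂ) = Complex.exp (μ * (Real.log ‖z‖ : ℝ)) := hμ _
  have e2 : (χ (ua (Complex.arg z)) : ℂ) = Complex.exp (μ' * (Complex.arg z : ℝ)) := hμ' _
  have hsq : ((‖z‖ ^ 2 : ℝ) : ℂ) ≠ 0 := by exact_mod_cast (pow_pos hnz 2).ne'
  rw [hχy, e1, e2, hnorm, hθ, ← Complex.exp_int_mul, hμ'k, Complex.cpow_def_of_ne_zero hsq,
    ← Complex.ofReal_log (pow_pos hnz 2).le, Real.log_pow]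
  push_cast
  congr 1 <;> congr 1 <;> ring

/-- **Every idèle class character has archimedean parameters** (Booker–Krishnamurthy 2011,
§1.1, p. 672): there is a family `P` with `ω.HasArchParams P` — at each real place by
`exists_hasRealParam_of_continuous`, at each complex place by
`exists_hasComplexParam_of_continuous`, applied to the continuous components `ω_w`
(`HeckeCharacter.continuous_archComponent`). In particular the clause
`∀ P, ω.HasArchParams P → …` of `bookerKrishnamurthy_isPiOfArtinRep_of_entire_twists` is never
vacuous. [cite: BookerKrishnamurthy2011, §1.1 (p. 672)] -/
theorem _root_.Literature.NumberTheory.GaloisRepresentations.HeckeCharacter.exists_hasArchParams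
    (ω : HeckeCharacter K) : ∃ P : ArchParams K, ω.HasArchParams P := by
  have hr : ∀ w : InfinitePlace K, ∀ hw : w.IsReal,
      ∃ p : ℂ × Fin 2, HasRealParam hw (ω.archComponent w) p.1 p.2 := fun w hw => by
    obtain ⟨ν, ε, h⟩ := exists_hasRealParam_of_continuous hw (ω.continuous_archComponent w)
    exact ⟨(ν, ε), h⟩
  have hc : ∀ w : InfinitePlace K, w.IsComplex →
      ∃ p : ℂ × ℤ, HasComplexParam (ω.archComponent w) p.1 p.2 := fun w hw => by
    obtain ⟨ν, k, h⟩ := exists_hasComplexParam_of_continuous hw (ω.continuous_archComponent w)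
    exact ⟨(ν, k), h⟩
  choose pr hpr using hr
  choose pc hpc using hc
  classical
  refine ⟨⟨fun w => if hw : w.IsReal then (pr w hw).1 else (pc w (not_isReal_iff_isComplex.mp hw)).1,
    fun w => if hw : w.IsReal then (pr w hw).2 else 0,
    fun w => if hw : w.IsReal then 0 else (pc w (not_isReal_iff_isComplex.mp hw)).2⟩, fun w => ⟨?_, ?_⟩⟩
  · intro hw
    simp only [dif_pos hw]
    exact hpr w hw
  · intro hw
    have hnr : ¬ w.IsReal := not_isReal_iff_isComplex.mpr hw
    simp only [dif_neg hnr]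
    exact hpc w hw

/-- **The two quantifications over the parameters agree.** For an Artin representation `σ` and
an idèle class character `ω`, "`Λ(s, σ ⊗ ω)` is entire for every parameter family of `ω`"
(the clause of `bookerKrishnamurthy_isPiOfArtinRep_of_entire_twists`) is equivalent to
"`Λ(s, σ ⊗ ω)` is entire for some parameter family of `ω`" (existence:
`HeckeCharacter.exists_hasArchParams`; independence of the choice: `artinTwistCompletedL_congr`),
i.e. to the printed hypothesis "`Λ(s, ρ ⊗ ω)` is entire" read with THE parameters of `ω`.
[cite: BookerKrishnamurthy2011, Cor. 1.2 (p. 670)] -/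
theorem forall_hasArchParams_hasEntireContinuation_iff {V : Type*} [AddCommGroup V] [Module ℂ V]
    [TopologicalSpace V] [FiniteDimensional ℂ V] (σ : ArtinRep K V) (ω : HeckeCharacter K) :
    (∀ P : ArchParams K, ω.HasArchParams P →
        LFunction.HasEntireContinuation (artinTwistCompletedL σ P ω)) ↔
      ∃ P : ArchParams K, ω.HasArchParams P ∧
        LFunction.HasEntireContinuation (artinTwistCompletedL σ P ω) := by
  refine ⟨fun h => ?_, hasEntireContinuation_forall_of_exists σ⟩
  obtain ⟨P, hP⟩ := ω.exists_hasArchParams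
  exact ⟨P, hP, h P hP⟩

end Existence

end Literature.NumberTheory.Automorphic

end
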